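/-
Copyright (c) 2026 the pub-hodgecm-mathlib formalisation cell (harness21).  Prover seat hodgecm-mathlib-K2E3-p06 (g5), Track B «K2-LIT», engine E3, unit U4 «Keys»; deal (D61)
LINE LEAD of the open leaf (U4f-χ₁-ram-one), design D-I, plan DESIGN-B v1 step (B3b) «THE TWO FAR CELL VALUES OF AN `(I, θ)`-TYPE VECTOR» on `U(Φ₃)(L⁺_v)`;
2026-09-04.  KERNEL module: THEOREMS ONLY (no definition, no named fact, no `sorry`, no instance, no notation).
-/
import Summits.HodgeConjecture.HodgeConjecture.Theorems.K2E3TypeVectorCellValues             -- ★-filed (B3a) (this seat): (A1) `toFun_weyl_mul_eq_of_height_le_one`, (A3) `toFun_weyl_mul_mul_weyl_inv_eq_of_height_lt_one`; brings ★ (B2), letters (i), the frame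
import Summits.HodgeConjecture.HodgeConjecture.Theorems.F0P3cStCharTSBigCellFactorisation    -- ★ B4∕FILE 1 (LH4): `toFun_weylElt_mul_eq_of_isUnit` (the far-out formula for ANY section), `exists_unipotentU_entries_eq`, `neg_one_mem_normOneUnits`
import Summits.HodgeConjecture.HodgeConjecture.Theorems.F0P3cStCharTSLocalRingNormDictionary  -- ★ DICT (LH4): `isUnit_iff_ne_zero_localRing`, `prod_normAbs_eq_zero_iff`
import HarnessLib

/-!
# K2 ∕ E3 «EllipticInputs», unit U4 «Keys» — (U4f-χ₁-ram-one) step (B3b) of DESIGN-B: THE FAR CELL VALUES (A2), (A4) OF AN `(I, θ)`-EIGEN SECTION OF `i(χ₁, χ₂)` ON `w₀ N` AND ON `N̄ = w₀ N w₀⁻¹`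
# (A1) `m ≤ 1`: `f(w₀u) = f(w₀)`; (A2) `m > 1`: `f(w₀u) = χ₁(σb)⁻¹χ₂(−1)‖b‖⁻¹·f(1)`; (A3) `m < 1`: `f(w₀uw₀⁻¹) = f(1)`; (A4) `m ≥ 1`: `f(w₀uw₀⁻¹) = χ₁(σb)⁻¹χ₂(−1)‖b‖⁻¹·f(w₀)`
# [Casselman1995 §6.4, Prop. 1.3.3; Keys1984 §3–§4; Roche1998 §3–§4; Rogawski1990 §4.5]

Cell hodgecm-mathlib (D-0151), FLOOR 0, Track B «K2-LIT», engine E3, crux item H413 = stmt-HodgeConjecture-24833 (route `HCCMUnconditional`, no route verbs); target BY NAME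
the OPEN leaf `…K2E3EllipticInputs.U4Keys.sig_K2E3KeysThmTwoContractingRamifiedCharOne` (U4Keys ED. 7; cand v5 leaf (U4f-χ₁-ram-one-d0B)), design D-I, plan `DESIGN-B-v1`
(`K2/K2E3-p06/g5/DESIGN-B-v1-BranchBDepthZero.K2E3-p06-g5.md`) step (B3).  Author K2E3-p06 (g5), line lead (D61).  `--supports stmt-HodgeConjecture-24833 --as helper`; THEOREMS ONLY.
NOT THE PAYER: the input of (B4), the Branch-B determinant identity `G₁G₂ = μ(B₀)μ(B_{-1})`.

THE POINT.  `f` a section of `i(χ₁, χ₂)` (★ `cmPrincipalSeries` carrier) which is `(I, θ)`-EIGEN, read POINTWISE: `f(g b) = θ(b) f(g)` for `b ∈ I = K₀ ⊓ K₁` (the (G3)-frame Iwahori; §0 derives this from `b·f = θ(b)•f`), `θ(g) = χ₁(g₀₀)` (when a unit;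
the depth-zero Iwahori character ★ Z2A-1∕3b) — e.g. the type vector of ★ (B1).  `u ∈ N(L⁺_v)`, `b = u₀₂`, height `m(u) = Π_{w′}|b_{w′}| = ‖b‖`, weight `c(b) = χ₁(σ b)⁻¹ · χ₂(−1) · ‖b‖⁻¹`
(the integrand of ★ `toFun_weylElt_mul_eq_of_isUnit`).  The spherical file ★ `K2E3SphericalCellFunction` computed `f(w₀u)` for a `K_v`-FIXED `f`; here `f` is only `I`-eigen, and BOTH
charts `w₀N` (for `Λ_1`) and `N̄ = w₀Nw₀⁻¹` (for `Λ_{w₀⁻¹}`) are needed, with DIFFERENT thresholds (`≤ 1 ∕ > 1` resp. `< 1 ∕ ≥ 1`):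
* (prequel ★ `K2E3TypeVectorCellValues`) §1 (A1) — `m(u) ≤ 1 ⟹ f(w₀u) = f(w₀)` (`u ∈ I` ★ (B2), `θ(u) = 1` ★ (B2) §3).
* (prequel) §2 (A3) — `m(u) < 1 ⟹ f(w₀uw₀⁻¹) = f(1)` (`w₀uw₀⁻¹ ∈ I` ★ (B2) §2, `θ(w₀uw₀⁻¹) = 1` ★ `theta_conj_eq_one`).
* §3 **`toFun_weyl_mul_eq_of_one_lt_height`** (A2) — `m(u) > 1 ⟹ f(w₀u) = c(b)·f(1)`: ★ far-out formula `f(w₀u) = c(b)·f(w₀u′w₀⁻¹)`, `u′` of entries `(ab⁻¹, b⁻¹)` has `m(u′) = m(u)⁻¹ < 1`, §2.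
* §4 **`toFun_weyl_mul_mul_weyl_inv_eq_of_one_le_height`** (A4) — `m(u) ≥ 1 ⟹ f(w₀uw₀⁻¹) = c(b)·f(w₀)`: the far-out formula applied to the SECTION `w₀⁻¹·f` (`(w₀⁻¹·f)(g) = f(g w₀⁻¹)` definitionally),
  `w₀⁻¹w₀⁻¹ = 1`, and (A1) for `u′` (`m(u′) ≤ 1`).
HONEST LABEL: HC_CM is proved only modulo the 7 printed citations (2 remaining named inputs: hLiu418 = stmt-HodgeConjecture-24832, h413 = stmt-HodgeConjecture-24833)
until rung 0 closes; count-neutral — this file does NOT pay the leaf; no printed citation is discharged.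

## References
* [Casselman1995] W. Casselman, *Introduction to the theory of admissible representations of `p`-adic reductive groups* (1995), Prop. 1.3.3, §6.4 pp. 62–64.
* [Keys1984] D. Keys, *Principal series representations of special unitary groups over local fields*, Compositio Math. 51 (1984), §3–§4.
* [Roche1998] A. Roche, Ann. Sci. ÉNS (4) 31 (1998), §3–§4 (`χ̃`-spherical vectors and their support).
* [Rogawski1990] J. D. Rogawski, *Automorphic Representations of Unitary Groups in Three Variables* (1990), §1.10 p. 9, §4.5 p. 45, §12.1 p. 171.
-/

set_option autoImplicit false
-- the mandated namespace has the single-problem summit's repeated segment (`HodgeConjecture.HodgeConjecture`)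
set_option linter.dupNamespace false

noncomputable section

open NumberField IsDedekindDomain MeasureTheory
open scoped Matrix MatrixGroups WithZero Valued NNReal
open Literature.NumberTheory Literature.NumberTheory.Automorphic Literature.NumberTheory.Automorphic.UnitaryGroup
open Literature.NumberTheory.Rogawski1990 Literature.NumberTheory.GaloisRepresentations Literature.NumberTheory.GaloisRepresentations.IsNonarchimedeanLocalField

namespace Summit.HodgeConjecture.HodgeConjecture.Cruxes.H413.K2E3TypeVectorCellValuesFar

open Summit.HodgeConjecture.HodgeConjecture.Cruxes.H413
open Summit.HodgeConjecture.HodgeConjecture.Cruxes.H413.K2E3DepthZeroIwahoriCharacterCM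
open Summit.HodgeConjecture.HodgeConjecture.Cruxes.H413.K2E3BranchALettersCM
open Summit.HodgeConjecture.HodgeConjecture.Cruxes.H413.K2E3IwahoriCellMembership
open Summit.HodgeConjecture.HodgeConjecture.Cruxes.H413.K2E3TypeVectorCellValues

variable (L : Type) [Field L] [NumberField L] [IsCMField L] (v : HeightOneSpectrum (𝓞 ↥(maximalRealSubfield L)))
  (w : PlacesOver L v) (hw : IsCMField.complexConj L • w.1 = w.1)
  (eA : Gqs L v ≃ₜ* ↥(unitaryGroupOfForm (galAdicCompletionMap (L := L) (IsCMField.complexConj L) hw) ((StdForm.antidiagonal 3).over (w.1.adicCompletion L))))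
  (heA : ∀ g : Gqs L v,
    ((eA g : ↥(unitaryGroupOfForm (galAdicCompletionMap (L := L) (IsCMField.complexConj L) hw) ((StdForm.antidiagonal 3).over (w.1.adicCompletion L)))) :
        GL (Fin 3) (w.1.adicCompletion L)) =
      ((localNonsplitEquiv (IsCMField.complexConj L) (qsForm L) (IsCMField.complexConj_ne_one L) w hw g :
        ↥(unitaryGroupOfForm (galAdicCompletionMap (L := L) (IsCMField.complexConj L) hw) (placeForm (qsForm L) w.1))) : GL (Fin 3) (w.1.adicCompletion L)))
  {ϖ : w.1.adicCompletion L} (hϖ : Valued.v ϖ = WithZero.exp (-1 : ℤ))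
  (g₁ : GL (Fin 3) (w.1.adicCompletion L)) (hg₁ : (g₁ : Matrix (Fin 3) (Fin 3) (w.1.adicCompletion L)) = Matrix.diagonal ![(1 : w.1.adicCompletion L), 1, ϖ])
  (K0 K1 I : Subgroup (Gqs L v))
  (hK0 : K0 = ((glInt 3 (w.1.adicCompletion L)).subgroupOf
    (unitaryGroupOfForm (galAdicCompletionMap (L := L) (IsCMField.complexConj L) hw) ((StdForm.antidiagonal 3).over (w.1.adicCompletion L)))).comap
      eA.toMulEquiv.toMonoidHom)
  (hK1 : K1 = (((glInt 3 (w.1.adicCompletion L)).map (MulAut.conj g₁).toMonoidHom).subgroupOf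
    (unitaryGroupOfForm (galAdicCompletionMap (L := L) (IsCMField.complexConj L) hw) ((StdForm.antidiagonal 3).over (w.1.adicCompletion L)))).comap
      eA.toMulEquiv.toMonoidHom)
  (hI : I = K0 ⊓ K1)
  (w₀ : ↥(unitaryGroupOfForm (conjLocal L (IsCMField.complexConj L) v) (cmLocalForm L 3 v))) (hw₀ : Units.val (w₀ : GL (Fin 3) (LocalRing L v)) = cmLocalForm L 3 v)
  (χ₁ : (LocalRing L v)ˣ →* ℂˣ) (χ₂ : ↥(normOneUnits (conjLocal L (IsCMField.complexConj L) v)) →* ℂˣ)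
  (f : haveI := locallyCompactSpace_cmBorelU L 3 v
    Representation.SmoothInd (cmBorelTriple L 3 v).P
      (Representation.twist
        (((Representation.trivial ℂ ↥(torusU (conjLocal L (IsCMField.complexConj L) v) (cmLocalForm L 3 v)) ℂ).twist
          (cmTorusCharPair L v χ₁ χ₂)).comp (cmBorelTriple L 3 v).proj) (rootDeltaChar (cmBorelTriple L 3 v).P)))

/-! ## §3 (A2) Far out on `w₀ N`: `f(w₀ u) = χ₁(σ b)⁻¹ χ₂(−1) ‖b‖⁻¹ · f(1)` -/

open Classical in
include hw heA hϖ hg₁ hK0 hK1 hI hw₀ in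
set_option synthInstance.maxHeartbeats 400000 in
set_option maxHeartbeats 6000000 in
-- statement∕proof over the `SmoothInd` carrier of ★ `cmPrincipalSeries` (class of ★ `K2E3SphericalCellFunction.toFun_weylElt_mul_eq_of_one_lt_height`)
/-- **(A2) THE FAR-OUT CELL VALUE OF AN `(I, θ)`-EIGEN SECTION: `m(u) > 1 ⟹ f(w₀ u) = χ₁(σ b)⁻¹ · χ₂(−1) · ‖b‖⁻¹ · f(1)`**, `b = u₀₂` (a unit).  ★ `toFun_weylElt_mul_eq_of_isUnit`
gives `f(w₀ u) = c(b)·f(w₀ u′ w₀⁻¹)` with `u′ ∈ N` of entries `(ab⁻¹, b⁻¹)` (★ `exists_unipotentU_entries_eq`); `m(u′) = ‖b‖⁻¹ < 1`, so §2 gives `f(w₀u′w₀⁻¹) = f(1)`.  For the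
`K_v`-fixed vector this is ★ `K2E3SphericalCellFunction` §4; the type vector needs only `w₀u′w₀⁻¹ ∈ I ∩ N̄`. [cite: Casselman1995, §6.4 p. 63; Prop. 1.3.3] [cite: Keys1984, §4] [cite: Roche1998, §3–§4] -/
theorem toFun_weyl_mul_eq_of_one_lt_height
    (heig : ∀ b : ↥(unitaryGroupOfForm (conjLocal L (IsCMField.complexConj L) v) (cmLocalForm L 3 v)), (b : Gqs L v) ∈ I → ∀ g : ↥(unitaryGroupOfForm (conjLocal L (IsCMField.complexConj L) v) (cmLocalForm L 3 v)),
      f.toFun (g * b) = (if h : IsUnit (((b : GL (Fin 3) (LocalRing L v)) : Matrix (Fin 3) (Fin 3) (LocalRing L v)) 0 0) then ((χ₁ h.unit : ℂˣ) : ℂ) else 0) * f.toFun g)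
    (u : ↥(cmBorelTriple L 3 v).N)
    (hu : 1 < (∏ w' : PlacesOver L v, normAbs (w'.1.adicCompletion L) ((((((u : ↥(unitaryGroupOfForm (conjLocal L (IsCMField.complexConj L) v) (cmLocalForm L 3 v)))) : GL (Fin 3) (LocalRing L v)) : Matrix (Fin 3) (Fin 3) (LocalRing L v)) 0 2) w')))
    (hb : IsUnit (((((u : ↥(unitaryGroupOfForm (conjLocal L (IsCMField.complexConj L) v) (cmLocalForm L 3 v)))) : GL (Fin 3) (LocalRing L v)) : Matrix (Fin 3) (Fin 3) (LocalRing L v)) 0 2)) :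
    f.toFun (w₀ * (u : ↥(unitaryGroupOfForm (conjLocal L (IsCMField.complexConj L) v) (cmLocalForm L 3 v)))) =
      ((((χ₁ (Units.map (conjLocal L (IsCMField.complexConj L) v : LocalRing L v →* LocalRing L v) hb.unit))⁻¹ : ℂˣ) : ℂ) *
          ((χ₂ ⟨-1, F0P3cStCharTSBigCellFactorisation.neg_one_mem_normOneUnits (conjLocal L (IsCMField.complexConj L) v)⟩ : ℂˣ) : ℂ) *
          ((((unitModulusChar (LocalRing L v) hb.unit)⁻¹ : ℝ≥0) : ℝ) : ℂ)) * f.toFun 1 := by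
  haveI := locallyCompactSpace_cmBorelU L 3 v
  letI : Invertible (2 : LocalRing L v) := (UnitaryGroup.isUnit_two_localRing L v).invertible
  obtain ⟨u', h1, h2⟩ := F0P3cStCharTSBigCellFactorisation.exists_unipotentU_entries_eq (conjLocal L (IsCMField.complexConj L) v)
    (conjLocal_conjLocal_cm L v) (cmLocalForm_eq_over L 3 v) u hb.unit hb.unit_spec.symm
  -- `m(u′) = m(u)⁻¹ < 1`
  have hnorm : ((unitModulusChar (LocalRing L v) hb.unit : ℝ≥0)) = (∏ w' : PlacesOver L v, normAbs (w'.1.adicCompletion L) ((((((u : ↥(unitaryGroupOfForm (conjLocal L (IsCMField.complexConj L) v) (cmLocalForm L 3 v)))) : GL (Fin 3) (LocalRing L v)) : Matrix (Fin 3) (Fin 3) (LocalRing L v)) 0 2) w')) := by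
    rw [unitModulusChar_localRing_eq_prod, hb.unit_spec]
  have hu' : (∏ w' : PlacesOver L v, normAbs (w'.1.adicCompletion L) ((((((u' : ↥(unitaryGroupOfForm (conjLocal L (IsCMField.complexConj L) v) (cmLocalForm L 3 v)))) : GL (Fin 3) (LocalRing L v)) : Matrix (Fin 3) (Fin 3) (LocalRing L v)) 0 2) w')) < 1 := by
    rw [h2, ← unitModulusChar_localRing_eq_prod, map_inv, hnorm]
    exact inv_lt_one_of_one_lt₀ hu
  rw [F0P3cStCharTSBigCellFactorisation.toFun_weylElt_mul_eq_of_isUnit L v χ₁ χ₂ w₀ hw₀ f u u' hb.unit hb.unit_spec.symm h1 h2,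
    toFun_weyl_mul_mul_weyl_inv_eq_of_height_lt_one L v w hw eA heA hϖ g₁ hg₁ K0 K1 I hK0 hK1 hI w₀ hw₀ χ₁ χ₂ f heig u' hu']

/-! ## §4 (A4) Far out on `N̄`: `f(w₀ u w₀⁻¹) = χ₁(σ b)⁻¹ χ₂(−1) ‖b‖⁻¹ · f(w₀)` -/

open Classical in
include hw heA hϖ hg₁ hK0 hK1 hI hw₀ in
set_option synthInstance.maxHeartbeats 400000 in
set_option maxHeartbeats 6000000 in
-- statement∕proof over the `SmoothInd` carrier of ★ `cmPrincipalSeries` (class of §3)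
/-- **(A4) `m(u) ≥ 1 ⟹ f(w₀ u w₀⁻¹) = χ₁(σ b)⁻¹ · χ₂(−1) · ‖b‖⁻¹ · f(w₀)`**, `b = u₀₂` (a unit), for an `(I, θ)`-eigen section `f`.  Apply the far-out formula ★
`toFun_weylElt_mul_eq_of_isUnit` to the SECTION `f₂ := w₀⁻¹·f` (`f₂(g) = f(g w₀⁻¹)`): `f(w₀uw₀⁻¹) = f₂(w₀u) = c(b)·f₂(w₀u′w₀⁻¹) = c(b)·f(w₀u′w₀⁻²) = c(b)·f(w₀u′)` (`w₀² = 1`), and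
`m(u′) = ‖b‖⁻¹ ≤ 1` gives `f(w₀u′) = f(w₀)` (§1).  This is the cell value of the type vector on `N̄ ∖ I = N̄ ∩ Bw₀I` needed for `Λ_{w₀⁻¹}`.
[cite: Casselman1995, §6.4 p. 63; Prop. 1.3.3] [cite: Keys1984, §3–§4] [cite: Roche1998, §3–§4] [cite: Rogawski1990, §4.5 p. 45] -/
theorem toFun_weyl_mul_mul_weyl_inv_eq_of_one_le_height
    (heig : ∀ b : ↥(unitaryGroupOfForm (conjLocal L (IsCMField.complexConj L) v) (cmLocalForm L 3 v)), (b : Gqs L v) ∈ I → ∀ g : ↥(unitaryGroupOfForm (conjLocal L (IsCMField.complexConj L) v) (cmLocalForm L 3 v)),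
      f.toFun (g * b) = (if h : IsUnit (((b : GL (Fin 3) (LocalRing L v)) : Matrix (Fin 3) (Fin 3) (LocalRing L v)) 0 0) then ((χ₁ h.unit : ℂˣ) : ℂ) else 0) * f.toFun g)
    (u : ↥(cmBorelTriple L 3 v).N)
    (hu : 1 ≤ (∏ w' : PlacesOver L v, normAbs (w'.1.adicCompletion L) ((((((u : ↥(unitaryGroupOfForm (conjLocal L (IsCMField.complexConj L) v) (cmLocalForm L 3 v)))) : GL (Fin 3) (LocalRing L v)) : Matrix (Fin 3) (Fin 3) (LocalRing L v)) 0 2) w')))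
    (hb : IsUnit (((((u : ↥(unitaryGroupOfForm (conjLocal L (IsCMField.complexConj L) v) (cmLocalForm L 3 v)))) : GL (Fin 3) (LocalRing L v)) : Matrix (Fin 3) (Fin 3) (LocalRing L v)) 0 2)) :
    f.toFun (w₀ * (u : ↥(unitaryGroupOfForm (conjLocal L (IsCMField.complexConj L) v) (cmLocalForm L 3 v))) * w₀⁻¹) =
      ((((χ₁ (Units.map (conjLocal L (IsCMField.complexConj L) v : LocalRing L v →* LocalRing L v) hb.unit))⁻¹ : ℂˣ) : ℂ) *
          ((χ₂ ⟨-1, F0P3cStCharTSBigCellFactorisation.neg_one_mem_normOneUnits (conjLocal L (IsCMField.complexConj L) v)⟩ : ℂˣ) : ℂ) *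
          ((((unitModulusChar (LocalRing L v) hb.unit)⁻¹ : ℝ≥0) : ℝ) : ℂ)) * f.toFun w₀ := by
  haveI := locallyCompactSpace_cmBorelU L 3 v
  letI : Invertible (2 : LocalRing L v) := (UnitaryGroup.isUnit_two_localRing L v).invertible
  obtain ⟨u', h1, h2⟩ := F0P3cStCharTSBigCellFactorisation.exists_unipotentU_entries_eq (conjLocal L (IsCMField.complexConj L) v)
    (conjLocal_conjLocal_cm L v) (cmLocalForm_eq_over L 3 v) u hb.unit hb.unit_spec.symm
  -- `m(u′) = m(u)⁻¹ ≤ 1`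
  have hnorm : ((unitModulusChar (LocalRing L v) hb.unit : ℝ≥0)) = (∏ w' : PlacesOver L v, normAbs (w'.1.adicCompletion L) ((((((u : ↥(unitaryGroupOfForm (conjLocal L (IsCMField.complexConj L) v) (cmLocalForm L 3 v)))) : GL (Fin 3) (LocalRing L v)) : Matrix (Fin 3) (Fin 3) (LocalRing L v)) 0 2) w')) := by
    rw [unitModulusChar_localRing_eq_prod, hb.unit_spec]
  have hu' : (∏ w' : PlacesOver L v, normAbs (w'.1.adicCompletion L) ((((((u' : ↥(unitaryGroupOfForm (conjLocal L (IsCMField.complexConj L) v) (cmLocalForm L 3 v)))) : GL (Fin 3) (LocalRing L v)) : Matrix (Fin 3) (Fin 3) (LocalRing L v)) 0 2) w')) ≤ 1 := by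
    rw [h2, ← unitModulusChar_localRing_eq_prod, map_inv, hnorm]
    exact inv_le_one_of_one_le₀ hu
  -- `w₀⁻¹ w₀⁻¹ = 1` (`eA w₀ = w`, `w · w = 1`; products read in `Gqs L v` for `map_mul`)
  have hww : @HMul.hMul (Gqs L v) (Gqs L v) (Gqs L v) instHMul w₀ w₀ = 1 :=
    eA.injective (by rw [map_mul, map_one, map_weyl_eq_weylLongU L v w hw eA heA w₀ hw₀, weylLongU_mul_weylLongU])
  have hww' : w₀ * w₀ = 1 := hww
  have hii : w₀⁻¹ * w₀⁻¹ = 1 := by rw [← mul_inv_rev, hww', inv_one]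
  -- the far-out formula for the section `f₂ := w₀⁻¹ · f`, read through `f₂(x) = f(x w₀⁻¹)` (definitional)
  set f₂ := Representation.smoothIndRep (cmBorelTriple L 3 v).P
    (Representation.twist
      (((Representation.trivial ℂ ↥(torusU (conjLocal L (IsCMField.complexConj L) v) (cmLocalForm L 3 v)) ℂ).twist
        (cmTorusCharPair L v χ₁ χ₂)).comp (cmBorelTriple L 3 v).proj) (rootDeltaChar (cmBorelTriple L 3 v).P)) w₀⁻¹ f with hf₂
  have hf₂val : ∀ x : ↥(unitaryGroupOfForm (conjLocal L (IsCMField.complexConj L) v) (cmLocalForm L 3 v)), f₂.toFun x = f.toFun (x * w₀⁻¹) :=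
    fun x => Representation.toFun_smoothIndRep_apply _ _ _
  have hfar := F0P3cStCharTSBigCellFactorisation.toFun_weylElt_mul_eq_of_isUnit L v χ₁ χ₂ w₀ hw₀ f₂ u u' hb.unit hb.unit_spec.symm h1 h2
  rw [hf₂val, hf₂val, mul_assoc (w₀ * (u' : ↥(unitaryGroupOfForm (conjLocal L (IsCMField.complexConj L) v) (cmLocalForm L 3 v)))), hii, mul_one,
    toFun_weyl_mul_eq_of_height_le_one L v w hw eA heA hϖ g₁ hg₁ K0 K1 I hK0 hK1 hI w₀ χ₁ χ₂ f heig u' hu'] at hfar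
  exact hfar

end Summit.HodgeConjecture.HodgeConjecture.Cruxes.H413.K2E3TypeVectorCellValuesFar

end
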